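import Summits.CriticalPhenomena.CardyFormulaZ2.Theorems.CardyIKTransportIKLinearTransportScreening

/-!
# `stub_Screening` PROVED (crux stmt-CriticalPhenomena-5076 `CardyIKTransport.IKLinearTransport`, line
# `pinned-diagram-exchange`) — part 2: the registered stub

Theorem-only file (`--supports stmt-CriticalPhenomena-5076`; proves the registered stub `stub_Screening` BY NAME
and signature). Part 1 (`…IKLinearTransportScreening.lean`) carries the screening inequality for synthetic
indicators (`screening_master`); here the events of the observables are pulled back along the μIK-preserving
anchored shear and rewritten as synthetic indicators (far/box agreement `obsShear_agree_far/_box`,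
environment-only reading `farObs_projEnv`/`boxObs_projEnv`, landed p120540), and `screening_error_small`
(p120454) furnishes `N(ε)`.

STATEMENT (`stub_Screening`): for every `ε > 0` there is `N` such that for all `n ≥ N`, every column pattern
`S`, every `w × h` box with `w, h ≤ 2n`, every measurable event `E` determined by the cells at sup-distance
`≥ n` from the box and every measurable event `L` determined by the box,
`|ν_S(E ∩ L) − ν_S(E) ν_S(L)| ≤ ε ν_S(E)` — far-field RATIO WEAK MIXING of the column-mixed Izergin–Korepin
gauge, uniformly in the pattern: the FKG-free substitute that turns unconditional RSW (route crux r4,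
stmt-5911) into conditional RSW (`conditionalRSW_of_screening`, p116422).
-/

noncomputable section

namespace Summit.CriticalPhenomena.CardyFormulaZ2.Theorems.IKLinearTransport.PinnedDiagramExchange.ScreeningAssembly

open scoped Classical symmDiff BigOperators
open MeasureTheory ProbabilityTheory Set
open Literature.Probability.Percolation Literature.Probability.LatticeModels
open ScreeningGauge ScreeningArray

/-! ### §5.5 From events of the observables to synthetic indicators -/

/-- Indicator of a pulled-back intersection as a product of synthetic indicators. [folklore] -/
theorem indicator_preimage_inter {α β γ : Type*} (g : α → β) (f : β → γ) (E L : Set γ) (P Q : α → Prop)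
    [∀ x, Decidable (P x)] [∀ x, Decidable (Q x)]
    (hP : ∀ x, f (g x) ∈ E ↔ P x) (hQ : ∀ x, f (g x) ∈ L ↔ Q x) (x : α) :
    (g ⁻¹' (f ⁻¹' (E ∩ L))).indicator (1 : α → ℝ) x = (if P x then 1 else 0) * (if Q x then 1 else 0) := by
  by_cases h1 : P x
  · by_cases h2 : Q x
    · rw [if_pos h1, if_pos h2,
        Set.indicator_of_mem (show x ∈ g ⁻¹' (f ⁻¹' (E ∩ L)) from ⟨(hP x).2 h1, (hQ x).2 h2⟩)]
      simp
    · rw [if_neg h2, mul_zero, Set.indicator_of_notMem]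
      exact fun h => h2 ((hQ x).1 h.2)
  · rw [if_neg h1, zero_mul, Set.indicator_of_notMem]
    exact fun h => h1 ((hP x).1 h.1)

/-- Indicator of a pulled-back event as a synthetic indicator. [folklore] -/
theorem indicator_preimage_eq {α β γ : Type*} (g : α → β) (f : β → γ) (E : Set γ) (P : α → Prop)
    [∀ x, Decidable (P x)] (hP : ∀ x, f (g x) ∈ E ↔ P x) (x : α) :
    (g ⁻¹' (f ⁻¹' E)).indicator (1 : α → ℝ) x = if P x then 1 else 0 := by
  by_cases h1 : P x
  · rw [if_pos h1, Set.indicator_of_mem (show x ∈ g ⁻¹' (f ⁻¹' E) from (hP x).2 h1)]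
    simp
  · rw [if_neg h1, Set.indicator_of_notMem]
    exact fun h => h1 ((hP x).1 h)

end Summit.CriticalPhenomena.CardyFormulaZ2.Theorems.IKLinearTransport.PinnedDiagramExchange.ScreeningAssembly

/-! ### §5.6 The registered stub -/

namespace Summit.CriticalPhenomena.CardyFormulaZ2.Theorems.IKLinearTransport.PinnedDiagramExchange

open scoped Classical symmDiff BigOperators
open MeasureTheory ProbabilityTheory Set
open Literature.Probability.Percolation Literature.Probability.LatticeModels
open ScreeningAssembly ScreeningGauge ScreeningArray

/-- STUB (v8) · `stub_Screening` — FAR-FIELD RATIO WEAK MIXING of the gauge colour field: for `n ≥ N(ε)`,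
every pattern `S`, every `w × h` box with `w, h ≤ 2n`, every measurable event `E` determined by the cells at
sup-distance `≥ n` from the box and every measurable event `L` determined by the box,
`|ν_S(E ∩ L) - ν_S(E) ν_S(L)| ≤ ε ν_S(E)`. PROOF: pull back along the `μIK`-preserving anchored shear
(`screenShear_measurePreserving`); by far/box agreement (`obsShear_agree_far`, `obsShear_agree_box`,
`farObs_projEnv`, `boxObs_projEnv`) the three events become synthetic indicators of
(environment, parities / box data of `Qarr`, `Cbox`), to which `screening_master` applies (`integral_env_arr_coins`,
`screeningArray`, `screeningOffset`, `boxObs_offset`); `screening_error_small` makes the error `≤ ε`. [folklore] -/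
theorem stub_Screening :
    ∀ ε : ℝ, 0 < ε → ∃ N : ℕ, ∀ (S : Set ℤ) (n : ℕ), N ≤ n → ∀ (a b : ℤ) (w h : ℕ),
      w ≤ 2 * n → h ≤ 2 * n → ∀ (E L : Set Obs), MeasurableSet E → MeasurableSet L →
      E ∈ determinedOn (farFrom a b w h n) →
      L ∈ determinedOn {v : Site 2 | a ≤ v 0 ∧ v 0 < a + w ∧ b ≤ v 1 ∧ v 1 < b + h} →
      |(νmix S).real (E ∩ L) - (νmix S).real E * (νmix S).real L| ≤ ε * (νmix S).real E := by
  intro ε hε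
  obtain ⟨N, hN1, hN⟩ := screening_error_small ε hε
  refine ⟨N, fun S n hn a b w h hw hh E L hE hL hEfar hLbox => ?_⟩
  have hn1 : 1 ≤ n := le_trans hN1 hn
  obtain ⟨hσ1, hε'⟩ := hN n hn w h hw hh
  have hm : ((w + 2 * n - 1 : ℕ) : ℤ) = w + 2 * n - 1 := by omega
  have hk : ((h + 2 * n - 1 : ℕ) : ℤ) = h + 2 * n - 1 := by omega
  have hΨ := screenShear_measurePreserving S (a - n) (a + w + n) (b - n) (b + h + n)
  -- (F-E), (F-L): after the shear the observables factor through the synthetic ones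
  have hFE : ∀ ω : Ω, obs S (screenShear S (a - n) (a + w + n) (b - n) (b + h + n) ω) ∈ E ↔
      farObs S (a - n) (a + w + n) (b - n) (b + h + n) (w + 2 * n - 1) (h + 2 * n - 1) (projEnv a b w h n ω)
        (parities (Qarr S (a - n) (b - n) (w + 2 * n - 1) (h + 2 * n - 1) ω)) ∈ E := by
    intro ω
    refine hEfar _ _ fun v hv => ?_
    have hvb : v ∉ boxCells a b w h := by
      simp only [farFrom, boxCells, Set.mem_setOf_eq] at hv ⊢
      omega
    have h1 := obsShear_agree_far S a b w h n (w + 2 * n - 1) (h + 2 * n - 1) ω v hm hk hv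
    have h2 := farObs_projEnv S a b w h n (w + 2 * n - 1) (h + 2 * n - 1) ω
      (parities (Qarr S (a - n) (b - n) (w + 2 * n - 1) (h + 2 * n - 1) ω)) v hvb
    exact ⟨h1.1.trans h2.1.symm, h1.2.trans h2.2.symm⟩
  have hFL : ∀ ω : Ω, obs S (screenShear S (a - n) (a + w + n) (b - n) (b + h + n) ω) ∈ L ↔
      boxObs S (a - n) (a + w + n) (b - n) (b + h + n) a b w h (projEnv a b w h n ω)
        (boxData n w h (Qarr S (a - n) (b - n) (w + 2 * n - 1) (h + 2 * n - 1) ω)) (Cbox a b w h ω) ∈ L := by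
    intro ω
    rw [boxObs_projEnv]
    exact hLbox _ _ fun v hv => obsShear_agree_box S a b w h n (w + 2 * n - 1) (h + 2 * n - 1) ω v hm hk hv
  -- pull back to `Ω` along the measure-preserving shear
  have hpull : ∀ A : Set Obs, MeasurableSet A → (νmix S).real A =
      ∫ ω, (screenShear S (a - n) (a + w + n) (b - n) (b + h + n) ⁻¹' (obs S ⁻¹' A)).indicator
        (1 : Ω → ℝ) ω ∂μIK := by
    intro A hA
    rw [integral_indicator_one (hΨ.measurable (CouplingToLimits.measurable_obs S hA)), nuMix_real_eq S hA,
      hΨ.measureReal_preimage (CouplingToLimits.measurable_obs S hA).nullMeasurableSet]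
  -- the synthetic indicators and their properties
  have henvm : ∀ kk, Measurable fun x : Ω =>
      if farObs S (a - n) (a + w + n) (b - n) (b + h + n) (w + 2 * n - 1) (h + 2 * n - 1) x kk ∈ E
        then (1 : ℝ) else 0 := fun kk =>
    Measurable.ite (measurable_farObs S (a - n) (a + w + n) (b - n) (b + h + n) (w + 2 * n - 1)
      (h + 2 * n - 1) kk hE) measurable_const measurable_const
  have henv01 : ∀ (x : Ω) kk,
      0 ≤ (if farObs S (a - n) (a + w + n) (b - n) (b + h + n) (w + 2 * n - 1) (h + 2 * n - 1) x kk ∈ E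
        then (1 : ℝ) else 0) ∧
      (if farObs S (a - n) (a + w + n) (b - n) (b + h + n) (w + 2 * n - 1) (h + 2 * n - 1) x kk ∈ E
        then (1 : ℝ) else 0) ≤ 1 := fun x kk => by
    split_ifs <;> norm_num
  have hbm : ∀ t cc, Measurable fun x : Ω =>
      if boxObs S (a - n) (a + w + n) (b - n) (b + h + n) a b w h x t cc ∈ L then (1 : ℝ) else 0 :=
    fun t cc => Measurable.ite (measurable_boxObs S (a - n) (a + w + n) (b - n) (b + h + n) a b w h t cc hL)
      measurable_const measurable_const
  have hb01 : ∀ (x : Ω) t cc,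
      0 ≤ (if boxObs S (a - n) (a + w + n) (b - n) (b + h + n) a b w h x t cc ∈ L then (1 : ℝ) else 0) ∧
      (if boxObs S (a - n) (a + w + n) (b - n) (b + h + n) a b w h x t cc ∈ L then (1 : ℝ) else 0) ≤ 1 :=
    fun x t cc => by split_ifs <;> norm_num
  have hoff : ∀ x x' : Ω, ∃ (A : Fin w → Bool) (B : Fin h → Bool), ∀ t cc,
      (if boxObs S (a - n) (a + w + n) (b - n) (b + h + n) a b w h x' t cc ∈ L then (1 : ℝ) else 0) =
      (if boxObs S (a - n) (a + w + n) (b - n) (b + h + n) a b w h x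
        (fun ij => xor (t ij) (xor (A ij.1) (B ij.2))) cc ∈ L then (1 : ℝ) else 0) := by
    intro x x'
    obtain ⟨A, B, hAB⟩ := boxObs_offset S a b w h n x x'
    exact ⟨A, B, fun t cc => by rw [hAB]⟩
  have key := screening_master S a b w h n hn1 hσ1
    (fun x kk => if farObs S (a - n) (a + w + n) (b - n) (b + h + n) (w + 2 * n - 1) (h + 2 * n - 1) x kk ∈ E
      then (1 : ℝ) else 0)
    (fun x t cc => if boxObs S (a - n) (a + w + n) (b - n) (b + h + n) a b w h x t cc ∈ L then (1 : ℝ) else 0)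
    henvm henv01 hbm hb01 hoff
  rw [hpull _ (hE.inter hL), hpull _ hE, hpull _ hL,
    integral_congr_ae (Filter.Eventually.of_forall (indicator_preimage_inter
      (screenShear S (a - n) (a + w + n) (b - n) (b + h + n)) (obs S) E L _ _ hFE hFL)),
    integral_congr_ae (Filter.Eventually.of_forall (indicator_preimage_eq
      (screenShear S (a - n) (a + w + n) (b - n) (b + h + n)) (obs S) E _ hFE)),
    integral_congr_ae (Filter.Eventually.of_forall (indicator_preimage_eq
      (screenShear S (a - n) (a + w + n) (b - n) (b + h + n)) (obs S) L _ hFL))]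
  exact key.trans (mul_le_mul_of_nonneg_right hε' (integral_nonneg fun ω => (henv01 _ _).1))

end Summit.CriticalPhenomena.CardyFormulaZ2.Theorems.IKLinearTransport.PinnedDiagramExchange
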